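import Summits.BirchSwinnertonDyer.Rank1Residual.Additive.XMultRankZeroCyclotomicPrimeReduction
import Summits.BirchSwinnertonDyer.Rank1Residual.Additive.XGordRankZeroCyclotomicPrimeUpperHalf
import HarnessLib

/-!
# Line V19b, certificate forms: `BSD(W,p) ∧ BSD(V,p)`, the typed upper half and the Cassels–Tate
# squeeze for the (M)-rows at an odd `p` (`V = W^{(p*)}` multiplicative, ranks `(0,0)`), over
# `F = ℚ(ζ_p) = CyclotomicField p ℚ`, with Greenberg's displays taken from the named facts and the
# divisibility over `F` INLINE (cell `b2b-bsdres`, seat additive-p4)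

HONEST FRAMING (cell `b2b-bsdres`, run/shared/lean/b2b/bsd-rank1-residual/, verbatim in every
file): the goal of the cell is to DELETE the COMBINATION-SHAPED residual classes of the
Birch–Swinnerton-Dyer formula for ALL analytic-rank `≤ 1` elliptic curves over `ℚ` — "full BSD
formula for every rank `≤ 1` curve in class `C`" assembled STRICTLY from published theorems — so
that the rank-`≤ 1` remainder becomes exactly the CONSTRUCTION-SHAPED classes, which are TYPED
(missing-input `Prop`s), NOT attempted. This is not "finishing BSD". Seat additive-p4 (research route
on X3/X4); the labels of X3 and X4 are UNCHANGED by this file; nothing is booked here.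

Theorems only (no `def`, no `sorry`, no new named fact). §1: three ARITHMETIC lemmas turning the
inequality of the V19/V19b cores plus a numerical certificate into `BSD(W,p) ∧ BSD(V,p)` (unit rows),
`Typed.MissingUpperBoundAt W p` (`p ∤ #Ш_an(V)`), resp. `BSD(W,p)` by the Cassels–Tate squeeze
(`p ∣ #Ш_an(W)` rows with one `p`-descent certificate). §2–§3: the NON-SPLIT and SPLIT (M)-row
theorems over `F = CyclotomicField p ℚ` with Greenberg's displays DERIVED from the named facts
`Greenberg1999.thm41Analogue_charValue_rankZero_numberField` (A103) /
`….thm41Analogue_charValue_rankZero_split_baseChange` (A106), the Greenberg–Stevens derivative from the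
named fact `greenberg_stevens` (split), and the divisibility over `F` as an INLINE hypothesis of the
exact shape of the Wuthrich / Kato-as-attributed multiplicative all-branch readings (this gen's
Literature facts; the X3/X4 specialisations that plug them in are in the `…X3Facts` / `…X4Facts`
files). The numerical certificate is the one of line V19: `ord_p∏c(V) + ord_p∏c(W) + 2 ord_p#V(ℚ(ζ_p)) +
[v(o) + m(ord_p ϖ + ord_p ϖ') − ord_p ϖ − ord_p ϖ_mid] ≤ 2(ord_p#V(ℚ) + ord_p#W(ℚ)) + ord_p ∏_w c_w(V_F)`
(census of this gen: `run/shared/lean/b2b/bsd-rank1-residual/b2b-bsdres-additive-p4/V19B-CENSUS.tsv`).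
-/

noncomputable section

open scoped Classical MatrixGroups ModularForm

open CongruenceSubgroup WeierstrassCurve NumberField IsDedekindDomain
  Literature.NumberTheory.EllipticCurves Literature.NumberTheory.EllipticCurves.ModularForms
  Literature.NumberTheory.EllipticCurves.Rank1Residual
  Literature.NumberTheory.EllipticCurves.Rank1Residual.Typed
  Literature.NumberTheory.GaloisRepresentations

namespace Summit.BirchSwinnertonDyer.Rank1Residual.Additive

/-! ## §1 Arithmetic of the certificate -/

section Generic

variable (p : ℕ) [hp : Fact p.Prime]
  (V : WeierstrassCurve ℚ) [V.IsElliptic] [V.IsGloballyMinimal]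
  (W : WeierstrassCurve ℚ) [W.IsElliptic] [W.IsGloballyMinimal]

omit [V.IsGloballyMinimal] [W.IsGloballyMinimal] in
/-- **Unit rows.** If `#Ш_an(V) = q_V`, `#Ш_an(W) = q_W` with
`ord_p#Ш(V) + ord_p#Ш(W) + X ≤ ord_p q_V + ord_p q_W + Y` (the shape of the V19/V19b cores), the
certificate `Y ≤ X` holds and `q_V`, `q_W` are `p`-adic units, then (ranks `0`, GZK) `BSD(W,p)` and
`BSD(V,p)` (`Ш[p^∞] = 0` on both sides, `missingPPartAt_of_upper_of_shaAn_unit`).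
[cite: Miller2011LMS, §1 and Def. 1.1] -/
theorem XMultCyclotomicPrime.bsdp_of_ineq (hGZK : rank_eq_analyticRank_of_analyticRank_le_one)
    (hrV : V.analyticRank = 0) (hrW : W.analyticRank = 0) {X Y : ℤ}
    (h : ∃ qV qW : ℚ, shaAn V = (qV : ℂ) ∧ shaAn W = (qW : ℂ) ∧
      (padicValNat p V.shaOrder : ℤ) + padicValNat p W.shaOrder + X ≤ padicValRat p qV + padicValRat p qW + Y)
    (hcert : Y ≤ X) {qV qW : ℚ} (hqV : shaAn V = (qV : ℂ)) (hqW : shaAn W = (qW : ℂ))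
    (hvV : padicValRat p qV = 0) (hvW : padicValRat p qW = 0) : BSDp W p ∧ BSDp V p := by
  obtain ⟨qV', qW', hqV', hqW', hle⟩ := h
  have hqq : qV' = qV := by exact_mod_cast hqV'.symm.trans hqV
  have hqq' : qW' = qW := by exact_mod_cast hqW'.symm.trans hqW
  subst hqq hqq'
  rw [hvV, hvW] at hle
  have hV0 : (0 : ℤ) ≤ padicValNat p V.shaOrder := by positivity
  have hW0 : (0 : ℤ) ≤ padicValNat p W.shaOrder := by positivity
  have huW : MissingUpperBoundAt W p := ⟨qW', hqW', by rw [hvW]; linarith⟩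
  have huV : MissingUpperBoundAt V p := ⟨qV', hqV', by rw [hvV]; linarith⟩
  exact ⟨bsdp_of_missingPPartAt W p hGZK (by rw [hrW]; exact zero_le_one)
      (missingPPartAt_of_upper_of_shaAn_unit W p huW hqW' hvW),
    bsdp_of_missingPPartAt V p hGZK (by rw [hrV]; exact zero_le_one)
      (missingPPartAt_of_upper_of_shaAn_unit V p huV hqV' hvV)⟩

omit hp [V.IsElliptic] [V.IsGloballyMinimal] [W.IsElliptic] [W.IsGloballyMinimal] in
/-- **The typed upper half for `W`.** Same inequality and certificate, `ord_p q_V ≤ 0`: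
`ord_p #Ш(W) ≤ ord_p #Ш_an(W)`, i.e. `Typed.MissingUpperBoundAt W p`.
[cite: Miller2011LMS, §1 and Def. 1.1] -/
theorem XMultCyclotomicPrime.missingUpperBoundAt_of_ineq [Finite V.sha] {X Y : ℤ}
    (h : ∃ qV qW : ℚ, shaAn V = (qV : ℂ) ∧ shaAn W = (qW : ℂ) ∧
      (padicValNat p V.shaOrder : ℤ) + padicValNat p W.shaOrder + X ≤ padicValRat p qV + padicValRat p qW + Y)
    (hcert : Y ≤ X) {qV : ℚ} (hqV : shaAn V = (qV : ℂ)) (hvV : padicValRat p qV ≤ 0) :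
    MissingUpperBoundAt W p := by
  obtain ⟨qV', qW, hqV', hqW, hle⟩ := h
  have hqq : qV' = qV := by exact_mod_cast hqV'.symm.trans hqV
  subst hqq
  have hV0 : (0 : ℤ) ≤ padicValNat p V.shaOrder := by positivity
  exact ⟨qW, hqW, by linarith⟩

omit [V.IsGloballyMinimal] [W.IsGloballyMinimal] in
/-- **Cassels–Tate squeeze for `W`.** Same inequality and certificate, `ord_p q_V ≤ 0`,
`#Ш_an(W) = q` with `ord_p q ≤ 2k` and ONE `p`-descent certificate `p^{2k−1} ∣ #Ш(W)`: then `BSD(W,p)`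
(upper half + Cassels–Tate squareness `hCT` = bsd.S18).
[cite: SilvermanAEC2009, Thm. X.4.14] [cite: Miller2011LMS, §1 and Def. 1.1] -/
theorem XMultCyclotomicPrime.bsdp_of_casselsTate_of_ineq (hGZK : rank_eq_analyticRank_of_analyticRank_le_one)
    (hCT : exists_casselsTate_pairing (K := ℚ)) (hrV : V.analyticRank = 0) (hrW : W.analyticRank = 0)
    {X Y : ℤ}
    (h : ∃ qV qW : ℚ, shaAn V = (qV : ℂ) ∧ shaAn W = (qW : ℂ) ∧
      (padicValNat p V.shaOrder : ℤ) + padicValNat p W.shaOrder + X ≤ padicValRat p qV + padicValRat p qW + Y)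
    (hcert : Y ≤ X) {qV : ℚ} (hqV : shaAn V = (qV : ℂ)) (hvV : padicValRat p qV ≤ 0)
    {q : ℚ} (hq : shaAn W = (q : ℂ)) {k : ℕ} (hv : padicValRat p q ≤ 2 * k)
    (hdvd : p ^ (2 * k - 1) ∣ W.shaOrder) : BSDp W p := by
  haveI : Finite V.sha := (hGZK V (by rw [hrV]; exact zero_le_one)).2
  exact bsdp_of_missingPPartAt W p hGZK (by rw [hrW]; exact zero_le_one)
    (missingPPartAt_of_lower_of_upper W p
      (missingLowerBoundAt_of_casselsTate_of_pow_dvd W p hCT (hGZK W (by rw [hrW]; exact zero_le_one)).2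
        hq hv hdvd)
      (XMultCyclotomicPrime.missingUpperBoundAt_of_ineq p V W h hcert hqV hvV))

end Generic

/-! ## §2 NON-SPLIT twist: Greenberg from the named fact, divisibility inline -/

section Nonsplit

variable (p : ℕ) [hp : Fact p.Prime]
  (V : WeierstrassCurve ℚ) [V.IsElliptic] [V.IsGloballyMinimal]
  (W : WeierstrassCurve ℚ) [W.IsElliptic] [W.IsGloballyMinimal]

/-- **(M)-rows, NON-SPLIT twist, over `F = ℚ(ζ_p) = CyclotomicField p ℚ`, Greenberg's display from
the named fact.** `V/ℚ` globally minimal non-split multiplicative at the odd prime `p`,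
`W = C • V^{(p*)}` globally minimal additive at `p`, ranks `(0,0)`, `f` the newform of `V`,
`ϖ·Ω_V = Ω⁺_f`, `ϖ'·|Ω⁻(V)| = Ω⁻_f`, `L` THE `ω⁰`-branch (`IsMultPAdicLFunctionOf f p (−1) L`); the
divisibility over `ℚ(ζ_{p^∞})` INLINE (`hDivF`: the shape of
`Wuthrich2014.thm16_charIdeal_dvd_nonsplitMultiplicative_cyclotomicPrime` /
`…kato_…_nonsplitMultiplicative_cyclotomicPrime_of_surjective` specialised to `V`, `F`, `V ⊗ F`);
`hGr` = Greenberg LNM 1716 pp. 112–113 non-split display (named fact); other branch values non-zero.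
Conclusion: the inequality of `XNonsplitMultCyclotomicPrime.exists_padicVal_shaOrder_add_le`.
[cite: GreenbergLNM1716, §4 pp. 112–113] [cite: Wuthrich2014, Thm. 16 (p. 397), Thm. 3 (p. 383)] -/
theorem XNonsplitMultCyclotomicPrime.exists_padicVal_shaOrder_add_le_of_greenberg
    (hGr : Greenberg1999.thm41Analogue_charValue_rankZero_numberField)
    (hGZK : rank_eq_analyticRank_of_analyticRank_le_one) (hmod : hasEntireLFunction_rat)
    (hp2 : p ≠ 2) (C : VariableChange ℚ) (hC : C • V.quadraticTwist ((-1 : ℚ) ^ (p / 2) * p) = W)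
    (hmult : V.HasMultiplicativeReductionAtPrime p) (hns : ¬ V.HasSplitMultiplicativeReductionAtPrime p)
    (hadd : Addv W p) (hrV : V.analyticRank = 0) (hrW : W.analyticRank = 0)
    {N : ℕ} [NeZero N] {f : CuspForm (Gamma0 N) 2} (hf : IsNewformOf V f)
    (ϖ ϖ' : ℚ) (hϖ : (ϖ : ℝ) * V.realPeriodRat = plusPeriod f)
    (hϖ' : (ϖ' : ℝ) * V.imaginaryPeriodRat = minusPeriod f)
    (L : PowerSeries ℚ_[p]) (hL : IsMultPAdicLFunctionOf f p (-1) L)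
    (hDivF : ∀ (κ : ZpExtension (CyclotomicField p ℚ) p) (γ : Field.absoluteGaloisGroup (CyclotomicField p ℚ)),
      κ.IsCyclotomic → κ.IsTopGenerator γ →
      (∃ ζ : ℤ_[p]ˣ, IsOfFinOrder ζ ∧
        ((GaloisRep.cyclotomicCharacter (CyclotomicField p ℚ) p γ * ζ : ℤ_[p]ˣ) : ℤ_[p]) =
          (cyclotomicGenerator p : ℤ_[p])) →
      ∀ D : (V.baseChange (CyclotomicField p ℚ)).SelmerDualData κ γ,
        D.IsTorsion ∧ ∃ g ∈ D.charIdeal, ∃ u : ℤ_[p]ˣ,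
          iwasawaToPowerSeries p g =
            PowerSeries.C (((u : ℤ_[p]) : ℚ_[p]) * (ϖ : ℚ_[p]) ^ (p / 2) * (ϖ' : ℚ_[p]) ^ (p / 2)) *
              (L * ∏ i ∈ Finset.Ico 1 (p - 1),
                (if Even i then padicLFunctionPlusBranchMult f (-1 : ℚ_[p]) i
                  else padicLFunctionMinusBranchMult f (-1 : ℚ_[p]) i)))
    (hO : (∏ i ∈ (Finset.Ico 1 (p - 1)).erase (p / 2),
        PowerSeries.constantCoeff
          (if Even i then padicLFunctionPlusBranchMult f (-1 : ℚ_[p]) i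
            else padicLFunctionMinusBranchMult f (-1 : ℚ_[p]) i)) ≠ 0) :
    ∃ qV qW : ℚ, shaAn V = (qV : ℂ) ∧ shaAn W = (qW : ℂ) ∧
      (padicValNat p V.shaOrder : ℤ) + padicValNat p W.shaOrder +
          (padicValNat p (V.baseChange (CyclotomicField p ℚ)).tamagawaProduct +
            2 * (padicValNat p (Nat.card V.toAffine.Point) + padicValNat p (Nat.card W.toAffine.Point))) ≤
        padicValRat p qV + padicValRat p qW +
          (padicValNat p V.tamagawaProduct + padicValNat p W.tamagawaProduct +
          2 * padicValNat p (Nat.card (V.baseChange (CyclotomicField p ℚ)).toAffine.Point) +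
          (∏ i ∈ (Finset.Ico 1 (p - 1)).erase (p / 2),
              PowerSeries.constantCoeff
                (if Even i then padicLFunctionPlusBranchMult f (-1 : ℚ_[p]) i
                  else padicLFunctionMinusBranchMult f (-1 : ℚ_[p]) i)).valuation +
          ((p / 2 : ℕ) : ℤ) * (padicValRat p ϖ + padicValRat p ϖ') - padicValRat p ϖ -
          (if p % 4 = 1 then padicValRat p ϖ else padicValRat p ϖ')) := by
  haveI : IsCyclotomicExtension {p} ℚ (CyclotomicField p ℚ) := CyclotomicField.isCyclotomicExtension p ℚ
  obtain ⟨qV, qW, hqV, hqW, hle⟩ := XNonsplitMultCyclotomicPrime.exists_padicVal_shaOrder_add_le p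
    (CyclotomicField p ℚ) V W hGZK hmod hp2 C hC hmult hns hadd hrV hrW hf ϖ ϖ' hϖ hϖ' L hL hDivF
    (XMultCyclotomicPrime.greenbergF_nonsplit_of_fact p (CyclotomicField p ℚ) V hGr hp2 hmult hns) hO
  exact ⟨qV, qW, hqV, hqW, by linarith⟩

end Nonsplit

/-! ## §3 SPLIT twist: Greenberg and Greenberg–Stevens from the named facts, divisibility inline -/

section Split

variable (p : ℕ) [hp : Fact p.Prime]
  (V : WeierstrassCurve ℚ) [V.IsElliptic] [V.IsGloballyMinimal]
  (W : WeierstrassCurve ℚ) [W.IsElliptic] [W.IsGloballyMinimal]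

omit [V.IsGloballyMinimal] in
/-- **The `ω⁰`-branch at the split prime (Greenberg–Stevens)**: for THE function `L` with
`IsSplitMultPAdicLFunctionOf f p L`: `L(0) = 0` and `[T¹]L · log_p γ_cyc = e⁺ · 𝓛_p(V) · [0]⁺_f` with
`e⁺ = 1` — the hypotheses `hL0`, `hL1` of the split core, from the named fact `greenberg_stevens V p`
(Kobayashi 2006 Cor. 4.2). [cite: Kobayashi2006DocMath, Cor. 4.2 (p. 575)] -/
theorem constantCoeff_and_coeff_one_of_greenbergStevens_prime (hGS : greenberg_stevens V p)
    (Dq : TateParameterData V p) {N : ℕ} [NeZero N] {f : CuspForm (Gamma0 N) 2} (hf : IsNewformOf V f)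
    {L : PowerSeries ℚ_[p]} (hL : IsSplitMultPAdicLFunctionOf f p L) :
    PowerSeries.constantCoeff L = 0 ∧
      PowerSeries.coeff 1 L * padicLog p (cyclotomicGenerator p : ℚ_[p]) =
        (((1 : ℤ_[p]ˣ) : ℤ_[p]) : ℚ_[p]) * LInvariant Dq * (ratPlusSymbol f 0 : ℚ_[p]) := by
  obtain ⟨h0, h1⟩ := hGS Dq hf hL
  refine ⟨h0, ?_⟩
  rw [h1]
  push_cast
  ring

/-- **(M)-rows, SPLIT twist, over `F = ℚ(ζ_p) = CyclotomicField p ℚ`, Greenberg and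
Greenberg–Stevens from the named facts.** `V/ℚ` globally minimal split multiplicative at the odd prime
`p` (Tate datum `Dq`), `W = C • V^{(p*)}` globally minimal additive at `p`, ranks `(0,0)`, `f` the
newform of `V`, `ϖ·Ω_V = Ω⁺_f`, `ϖ'·|Ω⁻(V)| = Ω⁻_f`, `L` THE `ω⁰`-branch (`IsSplitMultPAdicLFunctionOf f p L`);
the divisibility INLINE in the printed `I`-shape (`hDivF`: `ι(T·g) = u ϖ^m ϖ'^m · L · ∏_{0<i} B_i`, the
shape of `Wuthrich2014.thm16_charIdeal_dvd_splitMultiplicative_cyclotomicPrime` /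
`…kato_…_splitMultiplicative_cyclotomicPrime_of_surjective` specialised); `hGr` = Greenberg's split
display (named fact A106), `hGS` = `greenberg_stevens V p` (named fact); other branch values non-zero.
Conclusion: the inequality of `XSplitMultCyclotomicPrime.exists_padicVal_shaOrder_add_le`.
[cite: GreenbergLNM1716, §4 pp. 112–113, §3 p. 94] [cite: Kobayashi2006DocMath, Cor. 4.2 (p. 575)]
[cite: Wuthrich2014, Thm. 16 (p. 397), Cor. 19 (pp. 398–399)] -/
theorem XSplitMultCyclotomicPrime.exists_padicVal_shaOrder_add_le_of_greenberg
    (hGr : Greenberg1999.thm41Analogue_charValue_rankZero_split_baseChange) (hGS : greenberg_stevens V p)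
    (hGZK : rank_eq_analyticRank_of_analyticRank_le_one) (hmod : hasEntireLFunction_rat)
    (hp2 : p ≠ 2) (C : VariableChange ℚ) (hC : C • V.quadraticTwist ((-1 : ℚ) ^ (p / 2) * p) = W)
    (Dq : TateParameterData V p) (hadd : Addv W p) (hrV : V.analyticRank = 0) (hrW : W.analyticRank = 0)
    {N : ℕ} [NeZero N] {f : CuspForm (Gamma0 N) 2} (hf : IsNewformOf V f)
    (ϖ ϖ' : ℚ) (hϖ : (ϖ : ℝ) * V.realPeriodRat = plusPeriod f)
    (hϖ' : (ϖ' : ℝ) * V.imaginaryPeriodRat = minusPeriod f)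
    (L : PowerSeries ℚ_[p]) (hL : IsSplitMultPAdicLFunctionOf f p L)
    (hDivF : ∀ (κ : ZpExtension (CyclotomicField p ℚ) p) (γ : Field.absoluteGaloisGroup (CyclotomicField p ℚ)),
      κ.IsCyclotomic → κ.IsTopGenerator γ →
      (∃ ζ : ℤ_[p]ˣ, IsOfFinOrder ζ ∧
        ((GaloisRep.cyclotomicCharacter (CyclotomicField p ℚ) p γ * ζ : ℤ_[p]ˣ) : ℤ_[p]) =
          (cyclotomicGenerator p : ℤ_[p])) →
      ∀ D : (V.baseChange (CyclotomicField p ℚ)).SelmerDualData κ γ,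
        D.IsTorsion ∧ ∃ g ∈ D.charIdeal, ∃ u : ℤ_[p]ˣ,
          iwasawaToPowerSeries p (PowerSeries.X * g) =
            PowerSeries.C (((u : ℤ_[p]) : ℚ_[p]) * (ϖ : ℚ_[p]) ^ (p / 2) * (ϖ' : ℚ_[p]) ^ (p / 2)) *
              (L * ∏ i ∈ Finset.Ico 1 (p - 1),
                (if Even i then padicLFunctionPlusBranchMult f (1 : ℚ_[p]) i
                  else padicLFunctionMinusBranchMult f (1 : ℚ_[p]) i)))
    (hO : (∏ i ∈ (Finset.Ico 1 (p - 1)).erase (p / 2),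
        PowerSeries.constantCoeff
          (if Even i then padicLFunctionPlusBranchMult f (1 : ℚ_[p]) i
            else padicLFunctionMinusBranchMult f (1 : ℚ_[p]) i)) ≠ 0) :
    ∃ qV qW : ℚ, shaAn V = (qV : ℂ) ∧ shaAn W = (qW : ℂ) ∧
      (padicValNat p V.shaOrder : ℤ) + padicValNat p W.shaOrder +
          (padicValNat p (V.baseChange (CyclotomicField p ℚ)).tamagawaProduct +
            2 * (padicValNat p (Nat.card V.toAffine.Point) + padicValNat p (Nat.card W.toAffine.Point))) ≤
        padicValRat p qV + padicValRat p qW +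
          (padicValNat p V.tamagawaProduct + padicValNat p W.tamagawaProduct +
          2 * padicValNat p (Nat.card (V.baseChange (CyclotomicField p ℚ)).toAffine.Point) +
          (∏ i ∈ (Finset.Ico 1 (p - 1)).erase (p / 2),
              PowerSeries.constantCoeff
                (if Even i then padicLFunctionPlusBranchMult f (1 : ℚ_[p]) i
                  else padicLFunctionMinusBranchMult f (1 : ℚ_[p]) i)).valuation +
          ((p / 2 : ℕ) : ℤ) * (padicValRat p ϖ + padicValRat p ϖ') - padicValRat p ϖ -
          (if p % 4 = 1 then padicValRat p ϖ else padicValRat p ϖ')) := by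
  haveI : IsCyclotomicExtension {p} ℚ (CyclotomicField p ℚ) := CyclotomicField.isCyclotomicExtension p ℚ
  obtain ⟨hL0, hL1⟩ := constantCoeff_and_coeff_one_of_greenbergStevens_prime p V hGS Dq hf hL
  obtain ⟨qV, qW, hqV, hqW, hle⟩ := XSplitMultCyclotomicPrime.exists_padicVal_shaOrder_add_le p
    (CyclotomicField p ℚ) V W hGZK hmod hp2 C hC Dq hadd hrV hrW hf ϖ ϖ' hϖ hϖ' L 1 hL0 hL1 hDivF
    (XMultCyclotomicPrime.greenbergF_split_of_fact p (CyclotomicField p ℚ) V hGr hp2 Dq) hO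
  exact ⟨qV, qW, hqV, hqW, by linarith⟩

end Split

end Summit.BirchSwinnertonDyer.Rank1Residual.Additive

end
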